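import Summits.ResolutionOfSingularities.ResolutionOfSingularities.Theorems.EquisingularLiftEquisingularLiftNatResolveOnePoint
import HarnessLib

/-!
# [OURS · L1 W4.5(b) · EL♮] FIRST RUNG `stub_elnat_le_two` — EL♮ holds for `n ≤ 2` (points, `ℙ¹`, `ℙ²`, plane curves)

Registered-stub file of the line `sections` (`L/w45b/EL-NATURAL/SkeletonELnat-v1.lean` d2ae315ead614bb4, planner
res-L1-w45b-plan-1; tri-1 audit pass) for the crux `EquisingularLiftNat` = stmt-ResolutionOfSingularities-20038 (route
EquisingularLift rev 3): the theorem `stub_elnat_le_two` below has EXACTLY the registered signature (the route decl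
`Theses.EquisingularLift.EquisingularLiftNat` at prime `p` with `n ≤ 2` inserted after the hypersurface hypothesis) and lives in the
skeleton's namespace, so the lead replaces that `sorry` by an import.

HONEST FRAMING. OURS (cell res-hironaka, crux chain w45b, slot W4.5(b)); NOT a statement of any manuscript; inside S's known regime
(T3 flag: a rung, not a witness); reporting sentence of record «typed door alive-by-theorem n ≤ 4, summit-equivalent n ≥ 5».
AI-written, weaker than expert review. No `sorry`; standard axioms.

PROOF (classical embedded resolution of plane curves, run in the FIXED ambient `ℙⁿ_{𝕎(k)}` with Hensel-SECTION centres):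
`O := 𝕎(k)` (`stub_wittRing`); for every graded `φ = MvPolynomial.map π`, `ℙⁿ_k = ℙⁿ_O ×_O k`
(`ProjectiveAmbientFibre.isPullback_projMap`), so `Y = range (ι ≫ Proj.map φ)` is closed, lies in the (irreducible) special fibre and
`V(Y)_red ≅ H`; if `H` is regular, zero steps; otherwise `dim H ≤ 1`, finitely many non-regular points (`stub_singFinite_of_le_two`),
and strong induction on their number with `isolatedPointDropNat_dimOne` — the tree's section engine re-run with EL♮'s E1 clause
«special-fibre points of the centre lie in the current strict transform», which holds because each centre is a section `≅ Spec O`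
whose only special-fibre point is the blown-up non-regular point. The stage predicate propagated is EL♮'s own induction principle.

* `isolatedPointDropNat_dimOne` — E1 version of `Cruxes.EquisingularLift.StrataSplit.isolatedPointDrop_dimOne`.
* `stub_elnat_le_two` — THE REGISTERED STUB (first rung of EL♮).

References: `Theorems/EquisingularLiftEquisingularLift{CurveCase,ResolveOnePointDimOne,RegularCase}.lean`,
`Theorems/EquisingularLiftCampaignW45bEquisingularLiftNatInstantiation.lean` (ambient block), Liu 2002 §8.1/§9.2, Kollár 2007 §1.4;
L/w45b/CRUX-PLAN.md v3 §2.
-/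

set_option linter.dupNamespace false -- mandated namespace `Summit.<Summit>.<Problem>` of this single-conjunct summit
set_option linter.overlappingInstances false -- signatures carry `[IsDomain O] [IsDiscreteValuationRing O]`

noncomputable section

open CategoryTheory CategoryTheory.Limits AlgebraicGeometry TopologicalSpace Topology
open MvPolynomial HomogeneousIdeal
open Literature.AlgebraicGeometry.Resolution
open AlgebraicGeometry.Scheme.IdealSheafData
open Summit.ResolutionOfSingularities.ResolutionOfSingularities.Theses.EquisingularLift.Split
open Summit.ResolutionOfSingularities.ResolutionOfSingularities.Cruxes.EquisingularLift.StrataSplit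

namespace Summit.ResolutionOfSingularities.ResolutionOfSingularities.Cruxes.EquisingularLiftNat.Sections

/-- **E1 version of `isolatedPointDrop_dimOne`** (`Split.IsolatedPointDrop` for CURVES with the E1 bookkeeping): a further chain
of SECTION blow-ups strictly lowers the number of non-regular points of the reduced strict transform, keeping irreducibility of the
special fibre, finiteness, good reduction and `dim ≤ 1`, and propagating any stage predicate `Ch` over the original base `P` that
is closed under E1 steps and implies `Split.Chain` — from `resolveOnePointNat_dimOne_dim` and the tree's `regularOverIso`.
[folklore] -/
theorem isolatedPointDropNat_dimOne (O : Type) [CommRing O] [IsDomain O] [IsDiscreteValuationRing O] [CharZero O]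
    [IsAdicComplete (IsLocalRing.maximalIdeal O) O] [IsAlgClosed (IsLocalRing.ResidueField O)]
    (P P₁ : Scheme.{0}) (q : P ⟶ Spec (.of O)) (Y : Closeds P)
    (Ch : ∀ X' : Scheme.{0}, (X' ⟶ P) → Set X' → Prop)
    (hChain : ∀ (X' : Scheme.{0}) (σ : X' ⟶ P) (S : Set X'), Ch X' σ S → Chain P (Y : Set P) X' σ S)
    (hStep : ∀ (X' X'' : Scheme.{0}) (σ' : X' ⟶ P) (S' : Set X') (C : X'.IdealSheafData) (τ : X'' ⟶ X'),
      Ch X' σ' S' → IsBlowup τ C → Scheme.IsRegular C.subscheme →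
      σ' '' (C.support : Set X') ⊆ {x : P | ¬ IsGenericPoint x (Y : Set P)} →
      (C.support : Set X') ∩ (σ' ≫ q) ⁻¹' {IsLocalRing.closedPoint O} ⊆ S' →
      Ch X'' (τ ≫ σ') (closure (τ ⁻¹' (S' \ (C.support : Set X')))))
    (σ₁ : P₁ ⟶ P) (S₁ : Set P₁) (hq : Smooth q) (hqp : IsProper q)
    (hY : (Y : Set P) ⊆ q ⁻¹' {IsLocalRing.closedPoint O}) (hYirr : IsIrreducible (Y : Set P))
    (hCh₁ : Ch P₁ σ₁ S₁) (hirr₁ : IsIrreducible ((σ₁ ≫ q) ⁻¹' {IsLocalRing.closedPoint O}))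
    (hfin₁ : (singSet S₁).Finite) (hgood₁ : GoodSet (σ₁ ≫ q) S₁)
    (hdim₁ : topologicalKrullDim ↥(vanishingIdeal (⟨closure S₁, isClosed_closure⟩ : Closeds P₁)).subscheme ≤ 1)
    (hne : (singSet S₁).Nonempty) :
    ∃ (P₂ : Scheme.{0}) (σ₂ : P₂ ⟶ P₁) (S₂ : Set P₂),
      topologicalKrullDim ↥(vanishingIdeal (⟨closure S₂, isClosed_closure⟩ : Closeds P₂)).subscheme ≤ 1 ∧
      Chain P₁ (closure S₁) P₂ σ₂ S₂ ∧ Ch P₂ (σ₂ ≫ σ₁) S₂ ∧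
      IsIrreducible (((σ₂ ≫ σ₁) ≫ q) ⁻¹' {IsLocalRing.closedPoint O}) ∧
      (singSet S₂).Finite ∧ GoodSet ((σ₂ ≫ σ₁) ≫ q) S₂ ∧ (singSet S₂).ncard < (singSet S₁).ncard := by
  classical
  have hch₁ : Chain P (Y : Set P) P₁ σ₁ S₁ := hChain _ _ _ hCh₁
  obtain ⟨x₀, hx₀⟩ := hne
  obtain ⟨P₂, σ₂, S₂, hdim₂, hch₂, hCh₂, hirr₂, V, hV, hiso, hreg₀⟩ :=
    resolveOnePointNat_dimOne_dim O P P₁ q Y Ch hChain hStep σ₁ S₁ hq hqp hY hYirr hCh₁ hirr₁ hgood₁ hdim₁ x₀ hx₀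
  -- generic points: `Y = closure {ξ}`, `closure S₁ = closure {ξ₁}`, `S₂ = closure {ξ₂}`, `σ₂ ξ₂ = ξ₁`
  obtain ⟨ξ, hξ⟩ : ∃ ξ : P, IsGenericPoint ξ (Y : Set P) := QuasiSober.sober hYirr Y.isClosed
  obtain ⟨ξ₁, hfib₁, hS₁⟩ := Chain.fibre hch₁ hξ
  have hcl₁ : closure S₁ = closure {ξ₁} := by rw [hS₁, closure_closure]
  have hgen₁ : IsGenericPoint ξ₁ (closure S₁) := by rw [isGenericPoint_def, hcl₁]
  have hirrS₁ : IsIrreducible (closure S₁) := by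
    rw [hcl₁]; exact isIrreducible_singleton.closure
  obtain ⟨ξ₂, hfib₂, hS₂⟩ := Chain.fibre hch₂ hgen₁
  have hσξ₂ : σ₂ ξ₂ = ξ₁ := by
    have : ξ₂ ∈ σ₂ ⁻¹' {ξ₁} := by rw [hfib₂]; rfl
    simpa using this
  -- the two reduced strict transforms and their inclusions
  have hrange₁ : Set.range (vanishingIdeal (⟨closure S₁, isClosed_closure⟩ : Closeds P₁)).subschemeι = closure S₁ := by
    rw [range_subschemeι, coe_support_vanishingIdeal]; rfl
  have hrange₂ : Set.range (vanishingIdeal (⟨closure S₂, isClosed_closure⟩ : Closeds P₂)).subschemeι = closure S₂ := by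
    rw [range_subschemeι, coe_support_vanishingIdeal]; rfl
  -- every point of the new strict transform lies over the old one
  have hcl₂ : closure S₂ = closure {ξ₂} := by rw [hS₂, closure_closure]
  have himg : ∀ z : ↥(vanishingIdeal (⟨closure S₂, isClosed_closure⟩ : Closeds P₂)).subscheme,
      (σ₂ ((vanishingIdeal (⟨closure S₂, isClosed_closure⟩ : Closeds P₂)).subschemeι z) : P₁) ∈ closure S₁ := by
    intro z
    have hz : ((vanishingIdeal (⟨closure S₂, isClosed_closure⟩ : Closeds P₂)).subschemeι z : P₂) ∈ closure S₂ :=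
      (Set.ext_iff.mp hrange₂ _).mp (Set.mem_range_self z)
    have hz' : ((vanishingIdeal (⟨closure S₂, isClosed_closure⟩ : Closeds P₂)).subschemeι z : P₂) ∈
        closure ({ξ₂} : Set P₂) := (Set.ext_iff.mp hcl₂ _).mp hz
    have h' : (σ₂ ((vanishingIdeal (⟨closure S₂, isClosed_closure⟩ : Closeds P₂)).subschemeι z) : P₁) ∈
        closure (σ₂ '' {ξ₂}) := image_closure_subset_closure_image σ₂.continuous ⟨_, hz', rfl⟩
    rw [Set.image_singleton, hσξ₂] at h'
    exact (Set.ext_iff.mp hcl₁ _).mpr h'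
  have hx : ∀ z : ↥(vanishingIdeal (⟨closure S₂, isClosed_closure⟩ : Closeds P₂)).subscheme,
      ∃ x : ↥(vanishingIdeal (⟨closure S₁, isClosed_closure⟩ : Closeds P₁)).subscheme,
        ((vanishingIdeal (⟨closure S₁, isClosed_closure⟩ : Closeds P₁)).subschemeι x : P₁) =
          σ₂ ((vanishingIdeal (⟨closure S₂, isClosed_closure⟩ : Closeds P₂)).subschemeι z) := by
    intro z
    have hz : (σ₂ ((vanishingIdeal (⟨closure S₂, isClosed_closure⟩ : Closeds P₂)).subschemeι z) : P₁) ∈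
        Set.range (vanishingIdeal (⟨closure S₁, isClosed_closure⟩ : Closeds P₁)).subschemeι :=
      (Set.ext_iff.mp hrange₁ _).mpr (himg z)
    obtain ⟨x, hx⟩ := hz
    exact ⟨x, hx⟩
  choose f hf using hx
  -- `f` maps the new non-regular points into the old ones minus `x₀`, injectively
  have hne₀ : ∀ z ∈ singSet S₂, f z ≠ x₀ := by
    intro z hz h0
    exact hz (hreg₀ z (by rw [← hf z, h0]))
  have hfV : ∀ z ∈ singSet S₂, ((vanishingIdeal (⟨closure S₁, isClosed_closure⟩ : Closeds P₁)).subschemeι (f z) : P₁) ∈ V :=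
    fun z hz => hV (f z) (hne₀ z hz)
  have hmaps : ∀ z ∈ singSet S₂, f z ∈ singSet S₁ \ {x₀} := by
    intro z hz
    refine ⟨?_, hne₀ z hz⟩
    intro hreg
    exact hz ((regularOverIso O P₁ P₂ (σ₁ ≫ q) σ₂ S₁ S₂ V hirrS₁ hch₂ hiso z (f z) (hf z).symm (hfV z hz)).1.mpr hreg)
  have hinj : Set.InjOn f (singSet S₂) := by
    intro z hz z' hz' hzz'
    obtain ⟨w, -, huniq⟩ := existsUnique_preimage σ₂ hiso (hfV z hz)
    have e1 : ((vanishingIdeal (⟨closure S₂, isClosed_closure⟩ : Closeds P₂)).subschemeι z : P₂) = w :=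
      huniq _ (hf z).symm
    have e2 : ((vanishingIdeal (⟨closure S₂, isClosed_closure⟩ : Closeds P₂)).subschemeι z' : P₂) = w :=
      huniq _ (by rw [hzz', hf z'])
    exact (vanishingIdeal (⟨closure S₂, isClosed_closure⟩ : Closeds P₂)).subschemeι.isClosedEmbedding.injective
      (e1.trans e2.symm)
  have hfin' : (singSet S₁ \ {x₀}).Finite := hfin₁.subset Set.sdiff_subset
  have hfin₂ : (singSet S₂).Finite := by
    have himf : (f '' singSet S₂).Finite := hfin'.subset (by rintro _ ⟨z, hz, rfl⟩; exact hmaps z hz)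
    exact (Set.finite_image_iff hinj).mp himf
  have hle : (singSet S₂).ncard ≤ (singSet S₁ \ {x₀}).ncard := Set.ncard_le_ncard_of_injOn f hmaps hinj hfin'
  have hlt : (singSet S₁ \ {x₀}).ncard < (singSet S₁).ncard := Set.ncard_sdiff_singleton_lt_of_mem hx₀ hfin₁
  -- good reduction at the remaining non-regular points is inherited from the points under them
  have hgood₂ : GoodSet ((σ₂ ≫ σ₁) ≫ q) S₂ := by
    intro z hz
    have hg : GoodAt (σ₁ ≫ q) ((vanishingIdeal (⟨closure S₁, isClosed_closure⟩ : Closeds P₁)).subschemeι (f z)) :=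
      hgood₁ (f z) (hmaps z hz).1
    have ht := (regularOverIso O P₁ P₂ (σ₁ ≫ q) σ₂ S₁ S₂ V hirrS₁ hch₂ hiso z (f z) (hf z).symm (hfV z hz)).2.mpr hg
    rwa [← Category.assoc] at ht
  exact ⟨P₂, σ₂, S₂, hdim₂, hch₂, hCh₂, hirr₂, hfin₂, hgood₂, lt_of_le_of_lt hle hlt⟩

/-- **`stub_elnat_le_two` — FIRST RUNG of EL♮: `EquisingularLiftNat` for `n ≤ 2`** (points, `ℙ¹`, `ℙ²` and every integral plane
curve), in the FIXED ambient `ℙⁿ_{𝕎(k)}` with `Y` the image of `H`, by blow-ups along Hensel SECTIONS through the non-regular points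
of the successive strict transforms; every centre `≅ Spec O` meets the special fibre exactly in the blown-up point of the current
strict transform (E1). Registered signature of `SkeletonELnat-v1` verbatim. [folklore; Liu 2002 §8.1/§9.2, Kollár 2007 §1.4] -/
theorem stub_elnat_le_two (p : ℕ) : p.Prime → ∀ (k : Type) [Field k] [CharP k p] [IsAlgClosed k] (n : ℕ) (H : AlgebraicGeometry.Scheme.{0}) (ι : H ⟶ (Literature.AlgebraicGeometry.Motives.projectiveSpace n k).left), AlgebraicGeometry.IsClosedImmersion ι → AlgebraicGeometry.IsIntegral H → (∀ y : (Literature.AlgebraicGeometry.Motives.projectiveSpace n k).left, ∃ U : (Literature.AlgebraicGeometry.Motives.projectiveSpace n k).left.affineOpens, y ∈ (U : (Literature.AlgebraicGeometry.Motives.projectiveSpace n k).left.Opens) ∧ (ι.ker.ideal U).IsPrincipal) → n ≤ 2 → ∃ (O : Type) (_ : CommRing O) (_ : IsDomain O) (_ : IsDiscreteValuationRing O) (_ : CharZero O) (π : O →+* k), Function.Surjective π ∧ (letI := MvPolynomial.gradedAlgebra (σ := Fin (n + 1)) (R := O); letI := MvPolynomial.gradedAlgebra (σ := Fin (n + 1))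 (R := k); ∀ (φ : MvPolynomial.homogeneousSubmodule (Fin (n + 1)) O →+*ᵍ MvPolynomial.homogeneousSubmodule (Fin (n + 1)) k) (hφ' : HomogeneousIdeal.irrelevant (MvPolynomial.homogeneousSubmodule (Fin (n + 1)) k) ≤ (HomogeneousIdeal.irrelevant (MvPolynomial.homogeneousSubmodule (Fin (n + 1)) O)).map φ), (∀ s, φ s = MvPolynomial.map π s) → ∀ Y : Set (AlgebraicGeometry.Proj (MvPolynomial.homogeneousSubmodule (Fin (n + 1)) O)), Y = Set.range (CategoryTheory.CategoryStruct.comp ι (AlgebraicGeometry.Proj.map φ hφ') : H ⟶ (AlgebraicGeometry.Proj (MvPolynomial.homogeneousSubmodule (Fin (n + 1)) O))) → ∃ (P' : AlgebraicGeometry.Scheme.{0}) (σ : P' ⟶ (AlgebraicGeometry.Proj (MvPolynomial.homogeneousSubmodule (Fin (n + 1)) O))) (S' : Set P'), (∀ Q : (∀ X' : AlgebraicGeometry.Scheme.{0}, (X' ⟶ (AlgebraicGeometry.Proj (MvPolynomial.homogeneousSubmodule (Fin (n + 1)) O))) → Set X' → Prop), Q (AlgebraicGeometry.Proj (MvPolynomial.homogeneousSubmodule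 (Fin (n + 1)) O)) (CategoryTheory.CategoryStruct.id _) Y → (∀ (X' X'' : AlgebraicGeometry.Scheme.{0}) (σ' : X' ⟶ (AlgebraicGeometry.Proj (MvPolynomial.homogeneousSubmodule (Fin (n + 1)) O))) (Y' : Set X') (C : X'.IdealSheafData) (τ : X'' ⟶ X'), Q X' σ' Y' → Literature.AlgebraicGeometry.Resolution.IsBlowup τ C → Literature.AlgebraicGeometry.Resolution.Scheme.IsRegular C.subscheme → σ' '' (C.support : Set X') ⊆ {x | ¬ IsGenericPoint x Y} → (C.support : Set X') ∩ (CategoryTheory.CategoryStruct.comp σ' (CategoryTheory.CategoryStruct.comp (AlgebraicGeometry.Proj.toSpecZero (MvPolynomial.homogeneousSubmodule (Fin (n + 1)) O)) (AlgebraicGeometry.Spec.map (CommRingCat.ofHom (algebraMap O (MvPolynomial.homogeneousSubmodule (Fin (n + 1)) O 0)))))) ⁻¹' {IsLocalRing.closedPoint O} ⊆ Y' → Q X'' (CategoryTheory.CategoryStruct.comp τ σ') (closure (τ ⁻¹' (Y' \ (C.support : Set X'))))) → Q P' σ S') ∧ IsIrreducible ((CategoryTheory.CategoryStruct.comp σ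 (CategoryTheory.CategoryStruct.comp (AlgebraicGeometry.Proj.toSpecZero (MvPolynomial.homogeneousSubmodule (Fin (n + 1)) O)) (AlgebraicGeometry.Spec.map (CommRingCat.ofHom (algebraMap O (MvPolynomial.homogeneousSubmodule (Fin (n + 1)) O 0)))))) ⁻¹' {IsLocalRing.closedPoint O}) ∧ Literature.AlgebraicGeometry.Resolution.Scheme.IsRegular (AlgebraicGeometry.Scheme.IdealSheafData.vanishingIdeal (⟨closure S', isClosed_closure⟩ : TopologicalSpace.Closeds P')).subscheme) := by
  classical
  intro hp k _ _ _ n H ι hι hH hpr hn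
  obtain ⟨O, i1, i2, i3, i4, i5, i6, π, hπ⟩ := stub_wittRing p hp k
  refine ⟨O, i1, i2, i3, i4, π, hπ, ?_⟩
  letI := MvPolynomial.gradedAlgebra (σ := Fin (n + 1)) (R := O)
  letI := MvPolynomial.gradedAlgebra (σ := Fin (n + 1)) (R := k)
  intro φ hφ' hφ Y hYdef
  subst hYdef
  -- the fixed ambient `P = ℙⁿ_O`, its structure morphism `q`, and the closed immersion `g : ℙⁿ_k ⟶ ℙⁿ_O` onto the special fibre
  set q : Proj (homogeneousSubmodule (Fin (n + 1)) O) ⟶ Spec (.of O) :=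
    Proj.toSpecZero (homogeneousSubmodule (Fin (n + 1)) O) ≫
      Spec.map (CommRingCat.ofHom (algebraMap O (homogeneousSubmodule (Fin (n + 1)) O 0))) with hq
  have hP := ProjectiveAmbientFibre.isPullback_projMap π φ hφ hπ hφ'
  set g : Proj (homogeneousSubmodule (Fin (n + 1)) k) ⟶ Proj (homogeneousSubmodule (Fin (n + 1)) O) :=
    Proj.map φ hφ' with hg
  haveI : IsClosedImmersion (Spec.map (CommRingCat.ofHom π)) := IsClosedImmersion.spec_of_surjective _ hπ
  haveI : IsClosedImmersion g := MorphismProperty.IsStableUnderBaseChange.of_isPullback hP.flip inferInstance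
  have hpt : ∀ x : Spec (.of k), Spec.map (CommRingCat.ofHom π) x = IsLocalRing.closedPoint O := by
    intro x
    rw [Spec.map_apply]
    apply PrimeSpectrum.ext
    rw [PrimeSpectrum.comap_asIdeal, CommRingCat.hom_ofHom, Ideal.eq_bot_of_prime x.asIdeal, ← RingHom.ker_eq_comap_bot]
    exact IsLocalRing.eq_maximalIdeal (RingHom.ker_isMaximal_of_surjective π hπ)
  have hgq : ∀ x, q (g x) = IsLocalRing.closedPoint O := fun x ↦
    (Scheme.Hom.comp_apply g q x).symm.trans
      ((congrArg (fun h : Proj (homogeneousSubmodule (Fin (n + 1)) k) ⟶ Spec (.of O) ↦ h x) hP.w).trans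
        ((Scheme.Hom.comp_apply _ _ x).trans (hpt _)))
  -- the closed immersion `f = ι ≫ g : H ⟶ ℙⁿ_O` and its (closed) range `Y`
  haveI := hH
  let ι' : H ⟶ Proj (homogeneousSubmodule (Fin (n + 1)) k) := ι
  haveI : IsClosedImmersion ι' := hι
  let f : H ⟶ Proj (homogeneousSubmodule (Fin (n + 1)) O) := ι' ≫ g
  let Yc : Closeds (Proj (homogeneousSubmodule (Fin (n + 1)) O)) := ⟨Set.range f, f.isClosedEmbedding.isClosed_range⟩
  have hYc : (Yc : Set (Proj (homogeneousSubmodule (Fin (n + 1)) O))) = Set.range (ι ≫ Proj.map φ hφ') := rfl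
  have hsub : (Yc : Set (Proj (homogeneousSubmodule (Fin (n + 1)) O))) ⊆ q ⁻¹' {IsLocalRing.closedPoint O} := by
    rintro _ ⟨x, rfl⟩
    show q (f x) = IsLocalRing.closedPoint O
    rw [show f x = g (ι' x) from Scheme.Hom.comp_apply _ _ x]
    exact hgq (ι' x)
  obtain ⟨hsm, hprop⟩ := stub_projectiveAmbientSmoothProper O n
  -- `H` is reduced, so the kernel of `f` is the vanishing ideal sheaf of its range: `V(Y) ≅ H`
  have hYker : vanishingIdeal Yc = f.ker := by
    rw [← Scheme.IdealSheafData.map_bot, ← Scheme.nilradical_eq_bot, ← Scheme.IdealSheafData.vanishingIdeal_top,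
      Scheme.IdealSheafData.map_vanishingIdeal]
    congr 1
    ext1
    change Set.range f = closure (f '' Set.univ)
    rw [Set.image_univ, f.isClosedEmbedding.isClosed_range.closure_eq]
  have hker : (vanishingIdeal Yc).subschemeι.ker = f.ker := by
    rw [Scheme.IdealSheafData.ker_subschemeι, hYker]
  haveI := IsClosedImmersion.isIso_lift _ f hker
  let e : (vanishingIdeal Yc).subscheme ≅ H := (asIso (IsClosedImmersion.lift _ f hker.le)).symm
  -- the special fibre of `ℙⁿ_O` is irreducible
  obtain ⟨-, -, -, hirr₀⟩ := stub_projectiveAmbientFibre O k π hπ n H ι hι hH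
  -- EL♮'s induction principle as a stage predicate over the fixed base, closed under E1 steps and implying `Split.Chain`
  obtain ⟨Ch, hCh⟩ : ∃ Ch : ∀ X' : Scheme.{0}, (X' ⟶ Proj (homogeneousSubmodule (Fin (n + 1)) O)) → Set X' → Prop,
      ∀ (X₁ : Scheme.{0}) (σ₁ : X₁ ⟶ Proj (homogeneousSubmodule (Fin (n + 1)) O)) (S₁ : Set X₁), Ch X₁ σ₁ S₁ ↔
      ∀ Q : (∀ X' : Scheme.{0}, (X' ⟶ Proj (homogeneousSubmodule (Fin (n + 1)) O)) → Set X' → Prop),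
        Q (Proj (homogeneousSubmodule (Fin (n + 1)) O)) (𝟙 _) (Yc : Set (Proj (homogeneousSubmodule (Fin (n + 1)) O))) →
        (∀ (X' X'' : Scheme.{0}) (σ' : X' ⟶ Proj (homogeneousSubmodule (Fin (n + 1)) O)) (Y' : Set X')
          (C : X'.IdealSheafData) (τ : X'' ⟶ X'), Q X' σ' Y' → IsBlowup τ C → Scheme.IsRegular C.subscheme →
          σ' '' (C.support : Set X') ⊆ {x | ¬ IsGenericPoint x (Yc : Set (Proj (homogeneousSubmodule (Fin (n + 1)) O)))} →
          (C.support : Set X') ∩ (σ' ≫ q) ⁻¹' {IsLocalRing.closedPoint O} ⊆ Y' →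
          Q X'' (τ ≫ σ') (closure (τ ⁻¹' (Y' \ (C.support : Set X'))))) →
        Q X₁ σ₁ S₁ := ⟨_, fun _ _ _ => Iff.rfl⟩
  have hChain : ∀ (X' : Scheme.{0}) (σ : X' ⟶ Proj (homogeneousSubmodule (Fin (n + 1)) O)) (S : Set X'),
      Ch X' σ S → Chain (Proj (homogeneousSubmodule (Fin (n + 1)) O))
        (Yc : Set (Proj (homogeneousSubmodule (Fin (n + 1)) O))) X' σ S :=
    fun X' σ S h Q h0 hs => (hCh X' σ S).mp h Q h0
      (fun X₁ X₂ σ' Y' C τ hQ hb hr hg' _ => hs X₁ X₂ σ' Y' C τ hQ hb hr hg')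
  have hStep : ∀ (X' X'' : Scheme.{0}) (σ' : X' ⟶ Proj (homogeneousSubmodule (Fin (n + 1)) O)) (S' : Set X')
      (C : X'.IdealSheafData) (τ : X'' ⟶ X'),
      Ch X' σ' S' → IsBlowup τ C → Scheme.IsRegular C.subscheme →
      σ' '' (C.support : Set X') ⊆ {x | ¬ IsGenericPoint x (Yc : Set (Proj (homogeneousSubmodule (Fin (n + 1)) O)))} →
      (C.support : Set X') ∩ (σ' ≫ q) ⁻¹' {IsLocalRing.closedPoint O} ⊆ S' →
      Ch X'' (τ ≫ σ') (closure (τ ⁻¹' (S' \ (C.support : Set X')))) :=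
    fun X' X'' σ' S' C τ h hb hr hg' hE => (hCh _ _ _).mpr fun Q h0 hs =>
      hs X' X'' σ' S' C τ ((hCh X' σ' S').mp h Q h0 hs) hb hr hg' hE
  have hCh₀ : Ch (Proj (homogeneousSubmodule (Fin (n + 1)) O)) (𝟙 _)
      (Yc : Set (Proj (homogeneousSubmodule (Fin (n + 1)) O))) := (hCh _ _ _).mpr fun Q h0 _ => h0
  -- it suffices to reach a stage with `Ch`, irreducible special fibre and regular reduced strict transform
  suffices goal : ∃ (P' : Scheme.{0}) (σ : P' ⟶ Proj (homogeneousSubmodule (Fin (n + 1)) O)) (S' : Set P'),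
      Ch P' σ S' ∧ IsIrreducible ((σ ≫ q) ⁻¹' {IsLocalRing.closedPoint O}) ∧
      Scheme.IsRegular (vanishingIdeal (⟨closure S', isClosed_closure⟩ : Closeds P')).subscheme by
    obtain ⟨P', σ, S', h1, h2, h3⟩ := goal
    exact ⟨P', σ, S', (hCh P' σ S').mp h1, h2, h3⟩
  -- CASE `H` regular: zero steps
  by_cases hHreg : Scheme.IsRegular H
  · refine ⟨_, 𝟙 _, (Yc : Set (Proj (homogeneousSubmodule (Fin (n + 1)) O))), hCh₀, ?_, ?_⟩
    · simpa only [Category.id_comp] using hirr₀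
    · have hZ : (⟨closure (Yc : Set (Proj (homogeneousSubmodule (Fin (n + 1)) O))), isClosed_closure⟩ :
          Closeds (Proj (homogeneousSubmodule (Fin (n + 1)) O))) = Yc := Closeds.ext Yc.isClosed.closure_eq
      rw [hZ]
      exact Scheme.IsRegular.of_iso e.inv hHreg
  -- CASE `H` a curve: `dim H ≤ 1`
  have hdimH : topologicalKrullDim H ≤ 1 := by
    by_contra h
    haveI := isIso_of_isClosedImmersion_projectiveSpace_of_not_dim_le_one ι hn h
    exact hHreg (Scheme.IsRegular.of_iso (inv ι) (isRegular_projectiveSpace n k))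
  -- generic point of `Y`; `Y` irreducible
  let ι₀ : H ⟶ Proj (homogeneousSubmodule (Fin (n + 1)) O) := e.inv ≫ (vanishingIdeal Yc).subschemeι
  have hrange : Set.range ι₀ = (Yc : Set (Proj (homogeneousSubmodule (Fin (n + 1)) O))) := by
    rw [← Scheme.IdealSheafData.coe_support_vanishingIdeal Yc, ← Scheme.IdealSheafData.range_subschemeι]
    ext x
    constructor
    · rintro ⟨h, rfl⟩
      exact ⟨e.inv h, (Scheme.Hom.comp_apply _ _ h).symm⟩
    · rintro ⟨y, rfl⟩
      obtain ⟨h, rfl⟩ := e.inv.surjective y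
      exact ⟨h, Scheme.Hom.comp_apply _ _ h⟩
  have hgen : IsGenericPoint (ι₀ (genericPoint H)) (Yc : Set (Proj (homogeneousSubmodule (Fin (n + 1)) O))) := by
    have h := (genericPoint_spec H).image ι₀.continuous
    rwa [Set.image_univ, ι₀.isClosedEmbedding.isClosed_range.closure_eq, hrange] at h
  have hYirr : IsIrreducible (Yc : Set (Proj (homogeneousSubmodule (Fin (n + 1)) O))) := by
    have h := (isIrreducible_singleton (x := ι₀ (genericPoint H))).closure
    rwa [hgen] at h
  -- the first stage: finitely many singular points, good reduction everywhere, dimension ≤ 1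
  have hfin₀ : (singSet (Yc : Set (Proj (homogeneousSubmodule (Fin (n + 1)) O)))).Finite :=
    singSet_finite_of_iso Yc e (stub_singFinite_of_le_two p hp k n H ι hι hH hpr hn)
  have hdim₀ : topologicalKrullDim ↥(vanishingIdeal (⟨closure (Yc : Set (Proj (homogeneousSubmodule (Fin (n + 1)) O))),
      isClosed_closure⟩ : Closeds (Proj (homogeneousSubmodule (Fin (n + 1)) O)))).subscheme ≤ 1 :=
    dim_le_of_iso Yc e hdimH
  -- strong induction on the number of non-regular points, carrying `Ch` / irreducibility / finiteness / good reduction / dim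
  suffices key : ∀ (m : ℕ) (P₁ : Scheme.{0}) (σ₁ : P₁ ⟶ Proj (homogeneousSubmodule (Fin (n + 1)) O)) (S₁ : Set P₁),
      Ch P₁ σ₁ S₁ →
      IsIrreducible ((σ₁ ≫ q) ⁻¹' {IsLocalRing.closedPoint O}) →
      (singSet S₁).Finite →
      GoodSet (σ₁ ≫ q) S₁ →
      topologicalKrullDim ↥(vanishingIdeal (⟨closure S₁, isClosed_closure⟩ : Closeds P₁)).subscheme ≤ 1 →
      (singSet S₁).ncard = m →
      ∃ (P' : Scheme.{0}) (σ : P' ⟶ Proj (homogeneousSubmodule (Fin (n + 1)) O)) (S' : Set P'), Ch P' σ S' ∧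
        IsIrreducible ((σ ≫ q) ⁻¹' {IsLocalRing.closedPoint O}) ∧
        Scheme.IsRegular (vanishingIdeal (⟨closure S', isClosed_closure⟩ : Closeds P')).subscheme from
    key _ _ (𝟙 _) (Yc : Set (Proj (homogeneousSubmodule (Fin (n + 1)) O))) hCh₀
      (by simpa only [Category.id_comp] using hirr₀) hfin₀
      (fun x _ => by rw [Category.id_comp]; exact stub_goodAtOfSmooth O _ _ hsm _) hdim₀ rfl
  intro m
  induction m using Nat.strong_induction_on with
  | _ m ih =>
    intro P₁ σ₁ S₁ hCh₁ hirr₁ hfin₁ hgood₁ hdim₁ hm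
    by_cases hne : (singSet S₁).Nonempty
    · obtain ⟨P₂, σ₂, S₂, hdim₂, -, hCh₂, hirr₂, hfin₂, hgood₂, hlt⟩ :=
        isolatedPointDropNat_dimOne O _ P₁ q Yc Ch hChain hStep σ₁ S₁ hsm hprop hsub hYirr hCh₁ hirr₁ hfin₁ hgood₁
          hdim₁ hne
      have hlt' : (singSet S₂).ncard < m := by
        rw [← hm]
        exact hlt
      exact ih _ hlt' P₂ (σ₂ ≫ σ₁) S₂ hCh₂ hirr₂ hfin₂ hgood₂ hdim₂ rfl
    · refine ⟨P₁, σ₁, S₁, hCh₁, hirr₁, fun x => ?_⟩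
      by_contra hx
      exact hne ⟨x, hx⟩

end Summit.ResolutionOfSingularities.ResolutionOfSingularities.Cruxes.EquisingularLiftNat.Sections

end
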